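import Summits.QuantumAdvantage.QuantumAdvantage.Theorems.CubicForrelationNearExactIsExactTwelveZ768OffDiv4B

/-!
# Crux `CubicForrelation.NearExactIsExact` (stmt-QuantumAdvantage-14043) — n = 12, level `≥ 6`, configuration `#Z = 512` (9-flat even set):
  off-flat energy `≤ 127` forces `8 ∣ e` off the flat (two rounds on a `Z`-free 10-flat)

Certificate seat `b2b-cforr-cert` (gen 26).  HONEST FRAMING: a finite-slice structure lemma (standard axioms) about cubic Boolean functions on
12 bits; it claims NO value of `θ₁₂`.  NOT summit progress.  A brick for the residual analysis of the level-`≥ 6` × level-`≥ 6` branch of the open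
window `57/64 < Φ < 29/32` (HOME/b2b-cforr-cert-g26/PROOF-N12-WINDOW-L6.md §3).

Setting: `W_g = 64u''` (`g` cubic), `Z = {u'' even} = x_Z ⊕ V₀` a 9-flat, `f` cubic, `e = u'' − (−1)^f` (even off `Z`).
THEOREM `tzf_off_div8_le127`: if `Σ_{x ∉ Z} e(x)² ≤ 127` then `8 ∣ e` off `Z`.
Proof.  For `y₀ ∉ Z` pick `d ∉ V₀` with `y₀ ⊕ d ∉ Z` (counting: `512 + 512 < 4096`); `F := y₀ ⊕ (V₀ ∪ (d ⊕ V₀))` is a 10-flat missing `Z` (two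
off-cosets).  On `F` the residual is even, with 6-flat sums `≡ 0 (mod 4)` and 7-flat sums `≡ 0 (mod 8)` (`gh_flat_dvd`).  Round 1
(`ws_erm_round`, `r = 5`): `e/2` odd on `≥ 2^{10−5} = 32` points of `F` would cost `≥ 128 > 127`, so `4 ∣ e` on `F`; round 2 (`r = 6`): `e/4` odd
on `≥ 2^{10−6} = 16` points would cost `≥ 16·16 = 256 > 127`, so `8 ∣ e` on `F ∋ y₀`.
(Compare gen 13's `tw6_off_flat`: the same two rounds on ONE coset `p ⊕ V₀` give only `16` resp. `8` points and need energy `≤ 56`.)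

Use: in the window a 9-flat side has `Σ_Z (e² − 1) + Σ_{Z^c} e² = Σ e² − 512 ≤ 383`; when the on-flat excess is `≥ 256` (e.g. `#L ≥ 32` points
with `|e| ≥ 3`) the off-flat energy is `≤ 127` and this lemma applies; with `8 ∣ e` off `Z`, gen 23's `tw23_levelSix_eight_prep768` and gen 26's
`tzf_Z512_div8_false` take over (…TwelveZ512Div8Dead, `tzf_levelSix_window_residual2`).

References: MacWilliams–Sloane (1977) Ch. 13 §3 (Reed–Muller codes on a flat); R. O'Donnell (2014) §3.3.  Axioms: the standard three.
-/

set_option linter.dupNamespace false -- D-0017: single-problem summit ⇒ `QuantumAdvantage.QuantumAdvantage` by design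

noncomputable section

namespace Summit.QuantumAdvantage.QuantumAdvantage.Theorems.CubicForrelation.NearExactIsExact

open Finset
open Literature.Computability.QuantumComplexity
open Literature.Computability.QuantumComplexity.BuzetChailloux (bxor zeroVec bxor_bxor_cancel_left bxor_zeroVec zeroVec_bxor bxor_comm
  bxor_self)
open Literature.Computability.QuantumComplexity.DerivativeWalsh (W)

/-- **Off-flat energy `≤ 127` forces `8 ∣ e` off the 9-flat** (module docstring).  Finite-slice statement, NOT summit progress. [this work] -/
theorem tzf_off_div8_le127 (f g : (Fin (6 + 6) → Bool) → Bool) (hf : IsDegLeFun 3 f) (hg : IsDegLeFun 3 g)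
    (u'' : (Fin (6 + 6) → Bool) → ℤ) (hu'' : ∀ x, W (fun y => signOf (g y)) x = (2 : ℝ) ^ 6 * (u'' x : ℝ))
    (V₀ : Finset (Fin (6 + 6) → Bool)) (xZ : Fin (6 + 6) → Bool) (h0 : zeroVec ∈ V₀)
    (hadd : ∀ a ∈ V₀, ∀ b ∈ V₀, bxor a b ∈ V₀) (hcardV : #V₀ = 512)
    (hS : (univ.filter fun x : Fin (6 + 6) → Bool => ¬ Odd (u'' x)) = V₀.image (bxor xZ))
    (hoff : ∑ x ∈ univ.filter (fun x => x ∉ univ.filter (fun x : Fin (6 + 6) → Bool => ¬ Odd (u'' x))),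
      (u'' x - sZ (f x)) ^ 2 ≤ 127) :
    ∀ y, y ∉ (univ.filter fun x : Fin (6 + 6) → Bool => ¬ Odd (u'' x)) → (8 : ℤ) ∣ u'' y - sZ (f y) := by
  classical
  set Z := univ.filter (fun x : Fin (6 + 6) → Bool => ¬ Odd (u'' x)) with hZdef
  set e : (Fin (6 + 6) → Bool) → ℤ := fun x => u'' x - sZ (f x) with hedef
  show ∀ y, y ∉ Z → (8 : ℤ) ∣ e y
  intro y₀ hy₀
  have huniv : #(univ : Finset (Fin (6 + 6) → Bool)) = 4096 := by simp
  have hZcard : #Z = 512 := by rw [hS, card_image_of_injective _ (iw_bxor_injective xZ), hcardV]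
  have hout : ∀ x, x ∉ Z → ∀ p ∈ V₀, bxor x p ∉ Z := fun x hx p hp => fl1_coset_out' hadd hS hx hp
  have heven : ∀ x, x ∉ Z → Even (e x) := fun x hx => gh_even_off f u'' x hx
  have himZ : ∀ c d : Fin (6 + 6) → Bool, d ∉ Z.image (bxor c) → bxor c d ∉ Z :=
    fun c d hd h => hd (mem_image.2 ⟨bxor c d, h, bxor_bxor_cancel_left c d⟩)
  -- a second off-coset
  obtain ⟨d, -, hd⟩ : ∃ d ∈ (univ : Finset (Fin (6 + 6) → Bool)), d ∉ V₀ ∪ Z.image (bxor y₀) :=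
    exists_mem_notMem_of_card_lt_card (by
      rw [huniv]
      calc #(V₀ ∪ Z.image (bxor y₀)) ≤ #V₀ + #(Z.image (bxor y₀)) := card_union_le _ _
        _ ≤ 512 + 512 := Nat.add_le_add hcardV.le (card_image_le.trans hZcard.le)
        _ < 4096 := by norm_num)
  rw [mem_union, not_or] at hd
  have hy₁ : bxor y₀ d ∉ Z := himZ y₀ d hd.2
  set V₁₀ := V₀ ∪ V₀.image (bxor d) with hV₁₀
  obtain ⟨h100, h10add, -, -, -⟩ := fo_double_closed V₀ h0 hadd d
  have h10card : #V₁₀ = 2 ^ 10 := by rw [hV₁₀, tzo_double_card V₀ hadd d hd.1, hcardV]; norm_num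
  -- the 10-flat `F = y₀ ⊕ V₁₀` misses `Z`
  set F := V₁₀.image (bxor y₀) with hF
  have hV10avoid : ∀ v ∈ V₁₀, bxor y₀ v ∉ Z :=
    tzo_avoid_double Z V₀ y₀ d (fun v hv => hout y₀ hy₀ v hv) (fun v hv => hout _ hy₁ v hv)
  have hFZ : ∀ x ∈ F, x ∉ Z := by
    intro x hx
    obtain ⟨v, hv, rfl⟩ := mem_image.1 hx
    exact hV10avoid v hv
  have hFst : ∀ x, x ∈ F → ∀ a ∈ V₁₀, bxor x a ∈ F := fun x hx a ha => fl1_coset_vadd h10add rfl hx ha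
  have hy₀F : y₀ ∈ F := mem_image.2 ⟨zeroVec, h100, bxor_zeroVec y₀⟩
  -- flat sums of the residual
  have hflat6 : ∀ (b : Fin (6 + 6) → Bool) (a : Fin 6 → Fin (6 + 6) → Bool),
      (4 : ℤ) ∣ ∑ ε : Fin 6 → Bool, e (fun j => b j ^^ decide (Odd #(univ.filter fun i => ε i && a i j))) := by
    intro b a
    have h := gh_flat_dvd (e := 2) f g hf hg u'' hu'' b a (by norm_num) (by norm_num)
    rwa [show ((2 : ℤ) ^ 2) = 4 by norm_num] at h
  have hflat7 : ∀ (b : Fin (6 + 6) → Bool) (a : Fin 7 → Fin (6 + 6) → Bool),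
      (8 : ℤ) ∣ ∑ ε : Fin 7 → Bool, e (fun j => b j ^^ decide (Odd #(univ.filter fun i => ε i && a i j))) := by
    intro b a
    have h := gh_flat_dvd (e := 3) f g hf hg u'' hu'' b a (by norm_num) (by norm_num)
    rwa [show ((2 : ℤ) ^ 3) = 8 by norm_num] at h
  -- energy count on a subset of `F`
  have hcount : ∀ (T : Finset (Fin (6 + 6) → Bool)) (c : ℤ), T ⊆ F → (∀ x ∈ T, c ≤ e x ^ 2) → c * #T ≤ 127 := by
    intro T c hT hc
    calc c * #T = ∑ x ∈ T, c := by rw [sum_const, nsmul_eq_mul, mul_comm]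
      _ ≤ ∑ x ∈ T, e x ^ 2 := sum_le_sum hc
      _ ≤ ∑ x ∈ univ.filter (fun x => x ∉ Z), e x ^ 2 :=
          sum_le_sum_of_subset_of_nonneg (fun x hx => mem_filter.2 ⟨mem_univ _, hFZ x (hT hx)⟩) fun x _ _ => sq_nonneg _
      _ ≤ 127 := hoff
  -- round 1: `4 ∣ e` on `F`
  have hp2 : ∀ y, y ∉ Z → e y = 2 * (e y / 2) := fun y hy =>
    (Int.mul_ediv_cancel' (even_iff_two_dvd.1 (heven y hy))).symm
  have hdiv4 : ∀ x ∈ F, (4 : ℤ) ∣ e x := by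
    rcases ws_erm_round V₁₀ h100 h10add h10card y₀ (fun y => e y / 2) 5 (fun b hb a ha => by
        have hpts : ∀ ε : Fin (5 + 1) → Bool, (fun j => b j ^^ decide (Odd #(univ.filter fun i => ε i && a i j))) ∈ F :=
          fun ε => ws_flatPt_mem V₁₀ h100 (· ∈ F) hFst (5 + 1) b hb a ha ε
        have h4 := hflat6 b a
        rw [sum_congr rfl fun ε _ => hp2 _ (hFZ _ (hpts ε)), ← mul_sum] at h4
        obtain ⟨k, hk⟩ := h4
        exact ⟨k, by linarith⟩) with hev | hbig
    · intro x hx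
      obtain ⟨k, hk⟩ := hev x hx
      exact ⟨k, by rw [hp2 x (hFZ x hx), hk]; ring⟩
    · exfalso
      have hT := hcount ((V₁₀.image (bxor y₀)).filter fun x => Odd (e x / 2)) 4 (fun x hx => (mem_filter.1 hx).1)
        (fun x hx => by
          have hx' := mem_filter.1 hx
          have hxZ : x ∉ Z := hFZ x hx'.1
          have h0' := Int.odd_iff.1 hx'.2
          have h2 := hp2 x hxZ
          have : e x ≤ -2 ∨ 2 ≤ e x := by omega
          have := tp_sq_ge (k := 2) (by norm_num) this
          linarith)
      norm_num at hbig
      have : (32 : ℤ) ≤ #((V₁₀.image (bxor y₀)).filter fun x => Odd (e x / 2)) := by exact_mod_cast (by omega)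
      linarith
  -- round 2: `8 ∣ e` on `F`
  have hp4 : ∀ x ∈ F, e x = 4 * (e x / 4) := fun x hx => (Int.mul_ediv_cancel' (hdiv4 x hx)).symm
  have hdiv8 : ∀ x ∈ F, (8 : ℤ) ∣ e x := by
    rcases ws_erm_round V₁₀ h100 h10add h10card y₀ (fun y => e y / 4) 6 (fun b hb a ha => by
        have hpts : ∀ ε : Fin (6 + 1) → Bool, (fun j => b j ^^ decide (Odd #(univ.filter fun i => ε i && a i j))) ∈ F :=
          fun ε => ws_flatPt_mem V₁₀ h100 (· ∈ F) hFst (6 + 1) b hb a ha ε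
        have h8 := hflat7 b a
        rw [sum_congr rfl fun ε _ => hp4 _ (hpts ε), ← mul_sum] at h8
        obtain ⟨k, hk⟩ := h8
        exact ⟨k, by linarith⟩) with hev | hbig
    · intro x hx
      obtain ⟨k, hk⟩ := hev x hx
      exact ⟨k, by rw [hp4 x hx, hk]; ring⟩
    · exfalso
      have hT := hcount ((V₁₀.image (bxor y₀)).filter fun x => Odd (e x / 4)) 16 (fun x hx => (mem_filter.1 hx).1)
        (fun x hx => by
          have hx' := mem_filter.1 hx
          have h0' := Int.odd_iff.1 hx'.2
          have h2 := hp4 x hx'.1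
          have : e x ≤ -4 ∨ 4 ≤ e x := by omega
          have := tp_sq_ge (k := 4) (by norm_num) this
          linarith)
      norm_num at hbig
      have : (16 : ℤ) ≤ #((V₁₀.image (bxor y₀)).filter fun x => Odd (e x / 4)) := by exact_mod_cast (by omega)
      linarith
  exact hdiv8 y₀ hy₀F

end Summit.QuantumAdvantage.QuantumAdvantage.Theorems.CubicForrelation.NearExactIsExact

end
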